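import Literature.NumberTheory.Automorphic.Liu2021.SplitPlaceHeckeEigenvaluesExplicit
import Literature.NumberTheory.GelbartRogawski1991.LocalSplittingQuadExtSplitMixedModel
import Literature.NumberTheory.GelbartRogawski1991.LocalSplittingUnitary
import HarnessLib

/-!
# [Liu2021, Lemma D.1 (2)] at a split place for THE `χ`-package of [GelbartRogawski1991, Prop. 3.1.1] ∕ [Kudla1994, Thm 3.1]:
# the local Hecke eigen-equations with `ν = χ_w`, at EITHER place `w ∣ v`

Topic `Literature/NumberTheory/Automorphic/Liu2021`; proof file (theorems only: no definition, no named fact, no instance, no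
`sorry`); count-neutral.

★ `splitPlace_chiCoinv_heckeOperator_localInt_apply_explicit` (`SplitPlaceHeckeEigenvaluesExplicit`) gives, at a place `v`
of `F` split in `E` and `w ∣ v` with `c • w ≠ w`, the two `U(J)(𝒪_v)`-level Hecke eigen-equations of the `χ`-coinvariant
theta quotient of `ω_s` at `N = 2`, for an ABSTRACT smooth unitary section `s` with a mixed model `(Γ, η)`, a character
`νK` with `η(κ_a) = νK(det a)` and `ν` pinned by `ν ∘ ι_w = νK`.  For THE section of the tree — the undoubling
`undoubleLoc (localSplittingDatumQuadExt … χ hχ).localSplitting` of the local datum of a global splitting character `χ`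
of `E/F` (`LocalDoubledUnitarySplittingDataQuadExt`; for a CM field this IS `localSplittingCMWith` ∕ `localSplittingCM`,
`LocalUnitarySplittingsCM`) — every one of these inputs is now a theorem of the tree:

* `hs` — `proj_undoubleLoc`; `hsm`, `hsu` — §1 below (`isSmooth_toRep_comp_undoubleLoc`,
  `isL2Isometric_toRep_comp_undoubleLoc` for ANY doubled datum with `|β| = 1`, and
  `norm_beta_localSplittingDatumQuadExt_eq_one` for `χ` unitary: the generic forms of
  `isSmooth_localSplittingCMWith`, `isL2Isometric_toRep_comp_localSplittingCMWith`, `norm_beta_localSplittingDatumCM_eq_one`);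
* `(Γ, hΓi, hmodel)`, `hη` — `exists_mixedModel_undoubleLoc_localSplittingDatumQuadExt'`, `chi_det_symm_map`
  (`LocalSplittingQuadExtSplitMixedModel`, at ANY split `w ∣ v`: the package's splitting does not depend on the chosen place);
* `ν := χ_w` (`χ.localComponent w`), `hν` by `rfl`.

So §2 `splitPlace_heckeOperator_localInt_apply_undoubleLoc_localSplittingDatumQuadExt` states the two eigen-equations for
`s = undoubleLoc (localSplittingDatumQuadExt … χ hχ).localSplitting` with `ν(ϖ_w) := χ_w(ϖ_w)` and NO model data among its
hypotheses, and §3 `splitPlace_heckeOperator_localInt_apply_localSplittingCM` is the same for a CM field `L/L⁺` and the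
tree's `localSplittingCM L 2 … θ hθ v = (finLocalSplittingsCM …).s v` (no measure in the statement).  With `θ = μᶜ`
conjugate self-dual, `θ_w = μ_w⁻¹` at both `w ∣ v` (`Automorphic/ConjugateSelfDualLocalValues`).  Written for the d6 line of
cell `hodgecm-mathlib` (card S4, «S4-loc(w)»); HC_CM is NOT proved by anything here.

## References

* Y. Liu, *Fourier–Jacobi cycles and arithmetic relative trace formula*, Cambridge J. Math. 9 (2021), App. D,
  Lemma D.1 (2) and its proof (first paragraph), p. 126. [Liu2021]
* S. S. Kudla, *Splitting metaplectic covers of dual reductive pairs*, Israel J. Math. 87 (1994), §3 Thm. 3.1. [Kudla1994]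
* S. Gelbart, J. Rogawski, *L-functions and Fourier–Jacobi coefficients for the unitary group U(3)*, Invent. Math. 105
  (1991), §3.1 Prop. 3.1.1 p. 455. [GelbartRogawski1991]
* C. Mœglin, M.-F. Vignéras, J.-L. Waldspurger, LNM 1291 (1987), Chap. 2 II.1 Rem. (6), II.8; Chap. 3 III.1.
  [MoeglinVignerasWaldspurger1987]
-/

set_option autoImplicit false

noncomputable section

open NumberField IsDedekindDomain Matrix
open _root_.MeasureTheory
open scoped MatrixGroups
open ValuativeRel
open Literature.RepresentationTheory (TwistedCoinv.rep TwistedCoinv.Coinv TwistedCoinv.mk)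
open Literature.RepresentationTheory.HeisenbergGroup (MpPsi leviOpPi ImplementerSection)
open Literature.RepresentationTheory.HeisenbergGroup.SymplecticMatrix (glEquiv)
open Literature.NumberTheory.Automorphic.Zelevinsky1980 (lastBlockLabel maxParabolicLeviChar)
open Literature.NumberTheory.Automorphic.UnitaryGroup
open Literature.NumberTheory.Automorphic Literature.NumberTheory.Weil1964
open Literature.RepresentationTheory.HarrisKudlaSweet1996 Literature.NumberTheory.GaloisRepresentations

/-! ## §1 Smoothness and unitarity of an undoubled local splitting; `|β| = 1` for the `χ`-datum -/

namespace Literature.NumberTheory.GelbartRogawski1991.UnitaryDualPair.LocalSplitting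

section Undoubled

variable (F : Type) [Field F] [NumberField F] (E : Type) [Field E] [NumberField E] [Algebra F E]
  [Algebra.IsQuadraticExtension F E] (c : E ≃ₐ[F] E) {δ : E} (hcδ : c δ = -δ) (hδ : δ ≠ 0) {d : F}
  (hd : δ * δ = algebraMap F E d) (v : HeightOneSpectrum (𝓞 F)) [MeasurableSpace (v.adicCompletion F)]
  [BorelSpace (v.adicCompletion F)] (μ : Measure (v.adicCompletion F)) [μ.IsAddHaarMeasure]
  (n : ℕ) {T₀ : Matrix (Fin n) (Fin n) F} (hT₀ : T₀.IsSymm) (hT₀d : IsUnit T₀.det)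
  {J : Matrix (Fin n) (Fin n) E} (hJ : J = T₀.map (algebraMap F E))
  {JD : Matrix (Fin (n + n)) (Fin (n + n)) E} (hJD : JD = (gramD F n T₀).map (algebraMap F E))

/-- **the local Weil representation along an undoubled splitting is smooth**: for ANY local splitting datum `D` of the
doubled group `H(F_v) = U(J^𝔻)(F_v)` (Lagrangian `ℓ_Δ`), every `Φ ∈ 𝒮(F_vⁿ)` has an open stabiliser under
`ω ∘ undoubleLoc D.localSplitting` (the preimage under `g ↦ g ⊕ 1` of the open stabiliser of `Φ ⊠ 1_{𝒪ⁿ}`; the proof of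
`isSmooth_localSplittingCMWith` for a general datum). [cite: MoeglinVignerasWaldspurger1987, Chap. 2 II.8] -/
theorem isSmooth_toRep_comp_undoubleLoc
    (D : LocalSplittingDatum F E c (n + n) hcδ hδ hd (gramD F n T₀) (gramD_isSymm F n hT₀) (isUnit_det_gramD F n hT₀d) hJD
      v μ (deltaLagrangian F v n) (deltaLagrangian_orthogonal F v n T₀ hT₀d)) :
    Representation.IsSmooth ((MpPsi.toRep (localSchrodinger F n T₀ v)).comp
      (undoubleLoc F E c v n hJ hJD hcδ hδ hd hT₀ hT₀d D.localSplitting D.proj_localSplitting)) := by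
  intro Φ
  have hne : unitVec F (Fin n) v ≠ 0 := fun h0 => by
    have h1 : ((unitVec F (Fin n) v : SchwartzBruhat (Fin n → v.adicCompletion F)) : (Fin n → v.adicCompletion F) → ℂ) 0 = 1 :=
      unitVec_apply_of_mem fun i _ => (v.adicCompletionIntegers F).zero_mem
    rw [h0, ZeroMemClass.coe_zero, Pi.zero_apply] at h1
    exact zero_ne_one h1
  obtain ⟨U, hU, hfix⟩ := exists_open_forall_toRep_undoubleLoc_eq F E c v n hJ hJD hcδ hδ hd hT₀ hT₀d D.localSplitting
    D.proj_localSplitting Φ hne (D.smooth (boxSB (v.adicCompletion F) (e₂ n) Φ (unitVec F (Fin n) v)))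
  exact Representation.isSmoothVector_of_le _ hU fun k hk => (Representation.mem_stabilizerSubgroup _ _ _).2 (hfix k hk)

/-- **the local Weil representation along an undoubled splitting is `L²(μ'ⁿ)`-isometric as soon as `|β| = 1`** (any Haar
`μ'` on `F_v`): `ω^𝔻(g ⊕ 1)(f₁ ⊠ f₂) = (ω(g) f₁) ⊠ f₂` with the doubled side isometric
(`LocalSplittingDatum.isL2Isometric_localOmega_of_norm_beta`) and `f₂ ≠ 0` (`l2NormSq_eq_of_boxSB_linear`); the proof of
`isL2Isometric_toRep_comp_localSplittingCMWith` for a general datum.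
[cite: MoeglinVignerasWaldspurger1987, Chap. 2 II.1 Rem. (6)] [cite: Kudla1994, §3 Thm. 3.1] -/
theorem isL2Isometric_toRep_comp_undoubleLoc
    (D : LocalSplittingDatum F E c (n + n) hcδ hδ hd (gramD F n T₀) (gramD_isSymm F n hT₀) (isUnit_det_gramD F n hT₀d) hJD
      v μ (deltaLagrangian F v n) (deltaLagrangian_orthogonal F v n T₀ hT₀d))
    (hβ : ∀ g : UnitaryGroup.localPi E c (n + n) JD v, ‖((D.beta g : ℂˣ) : ℂ)‖ = 1)
    (μ' : Measure (v.adicCompletion F)) [μ'.IsAddHaarMeasure] :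
    Representation.IsL2Isometric (Measure.pi fun _ : Fin n => μ')
      ((MpPsi.toRep (localSchrodinger F n T₀ v)).comp
        (undoubleLoc F E c v n hJ hJD hcδ hδ hd hT₀ hT₀d D.localSplitting D.proj_localSplitting)) := by
  intro g f₁
  haveI : Nontrivial (SchwartzBruhat (Fin n → v.adicCompletion F)) :=
    Literature.RepresentationTheory.HeisenbergGroup.nontrivial_schwartzBruhat_pi
  obtain ⟨f₂, hf₂⟩ := exists_ne (0 : SchwartzBruhat (Fin n → v.adicCompletion F))
  have hA := D.isL2Isometric_localOmega_of_norm_beta μ' hβ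
  have hA' : ∀ Φ, SchwartzBruhat.l2NormSq (Measure.pi fun _ : Fin (n + n) => μ')
      (MpPsi.toRep _ (D.localSplitting (inlLoc F E c v n hJ hJD g)) Φ) =
        SchwartzBruhat.l2NormSq (Measure.pi fun _ : Fin (n + n) => μ') Φ :=
    fun Φ => hA (inlLoc F E c v n hJ hJD g) Φ
  have hAB := fun f : SchwartzBruhat (Fin n → v.adicCompletion F) =>
    toRep_undoubleLoc_boxSB F E c v n hJ hJD hcδ hδ hd hT₀ hT₀d D.localSplitting D.proj_localSplitting g f f₂
  exact l2NormSq_eq_of_boxSB_linear (v.adicCompletion F) μ' (e₂ n) _ hA' _ hf₂ hAB f₁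

end Undoubled

namespace QuadExt

variable (F : Type) [Field F] [NumberField F] (E : Type) [Field E] [NumberField E] [Algebra F E]
  [Algebra.IsQuadraticExtension F E] (c : E ≃ₐ[F] E) {δ : E} (hcδ : c δ = -δ) (hδ : δ ≠ 0) {d : F}
  (hd : δ * δ = algebraMap F E d) (v : HeightOneSpectrum (𝓞 F)) [MeasurableSpace (v.adicCompletion F)]
  [BorelSpace (v.adicCompletion F)] (μ : Measure (v.adicCompletion F)) [μ.IsAddHaarMeasure]
  (n : ℕ) {T₀ : Matrix (Fin n) (Fin n) F} (hT₀ : T₀.IsSymm) (hT₀d : IsUnit T₀.det)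
  {JD : Matrix (Fin (n + n)) (Fin (n + n)) E} (hJD : JD = (gramD F n T₀).map (algebraMap F E))

/-- **`|β(g)| = 1` for the local datum of a UNITARY global splitting character `χ` of `E/F`** at every finite place: the
split datum at a split place (`norm_beta_split_eq_one`), the non-split datum otherwise (`norm_beta_nonsplit_eq_one`); the
proof of `norm_beta_localSplittingDatumCM_eq_one` for a general quadratic `E/F`.
[cite: Kudla1994, §3 Thm. 3.1] [cite: GelbartRogawski1991, §3.1 Prop. 3.1.1 p. 455] -/
theorem norm_beta_localSplittingDatumQuadExt_eq_one (χ : HeckeCharacter E) (hχ : IsSplittingCharExt F E 1 χ)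
    (hχu : χ.IsUnitary) (g : UnitaryGroup.localPi E c (n + n) JD v) :
    ‖(((localSplittingDatumQuadExt F E c hcδ hδ hd v μ n hT₀ hT₀d hJD χ hχ).beta g : ℂˣ) : ℂ)‖ = 1 := by
  have hχu' : ∀ (w : PlacesOver E v) (x : (w.1.adicCompletion E)ˣ),
      ‖((((fun w' : PlacesOver E v => (χ.localComponent w'.1)⁻¹) w) x : ℂˣ) : ℂ)‖ = 1 := fun w x => by
    rw [MonoidHom.inv_apply, Units.val_inv_eq_inv_val, norm_inv, HeckeCharacter.localComponent_apply, hχu, inv_one]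
  unfold localSplittingDatumQuadExt
  split_ifs with h
  · exact norm_beta_split_eq_one F E c hcδ hδ hd v n hT₀ hT₀d hJD μ h.choose h.choose_spec _
      (isTrivialNearOne_localComponent_inv F E v χ h.choose) hχu' g
  · exact norm_beta_nonsplit_eq_one F E c hcδ hδ hd v n hT₀ hT₀d hJD μ _ _ _ _ _ hχu' g

end QuadExt

end Literature.NumberTheory.GelbartRogawski1991.UnitaryDualPair.LocalSplitting

/-! ## §2 The eigen-equations for the undoubled `χ`-package at a split place, `ν = χ_w` -/

namespace Literature.NumberTheory.Automorphic.Liu2021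

open Literature.NumberTheory.GelbartRogawski1991.UnitaryDualPair.LocalSplitting (iota LocalMp localSchrodinger undoubleLoc
  gramD proj_undoubleLoc isSmooth_toRep_comp_undoubleLoc isL2Isometric_toRep_comp_undoubleLoc hermD_conj_transpose
  isUnit_placeFormD localSplittingCMWith localSplittingCM)
open Literature.NumberTheory.GelbartRogawski1991.UnitaryDualPair.LocalSplitting.QuadExt
open Literature.NumberTheory.GelbartRogawski1991.UnitaryDualPair (imagUnit complexConj_imagUnit imagUnit_ne_zero imagUnit_mul_self)

set_option maxHeartbeats 2000000 in -- as in `SplitPlaceHeckeEigenvaluesExplicit`: ≈ 40 heavy binders, ≈ 1M heartbeats of `isDefEq`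
/-- **[Liu2021, Lem. D.1 (2)] at a split place, `N = 2`, for THE UNDOUBLED `χ`-PACKAGE, read at ANY `w ∣ v`: the local
Hecke eigen-equations with `ν = χ_w`.**  Data: a quadratic extension `E/F` of number fields (`c`, `δ`), `T = diag t ∈ GL₂(F)`,
`J = T ⊗ 1`, a place `v` of `F` split in `E` and ANY `w ∣ v` with `c • w ≠ w` (`J` invertible and of good reduction at `w`),
Haar data `μ` on `F_v`, a UNITARY global splitting character `χ` of `E/F` (`χ|_{𝕀_F} = ε_{E/F}`), a hermitian line `J₁` with a
unitary continuous character `χc` of the centre `U(J₁)(F_v)` and its `w`-reading `χ′` (`χ′(z_w) = χc(z)`), a uniformiser `ϖ`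
of `E_w`, and `s` THE undoubling of the package's local splitting, `s = undoubleLoc (localSplittingDatumQuadExt … χ hχ).localSplitting`
(hypothesis `hs`, `rfl` for the tree's terms).  Conclusion: on every `U(J)(𝒪_v)`-fixed vector `y` of the `χc`-coinvariants of
`ω_s`, the double coset operators of `e_w⁻¹(diag(ϖ, 1))` and `e_w⁻¹(diag(ϖ, ϖ))` act by
`q_w^{1/2}(χ_w(ϖ) + χ′(ϖ)χ_w(ϖ)⁻¹)` and by `χ′(ϖ)`.  Proof: `splitPlace_chiCoinv_heckeOperator_localInt_apply_explicit` with
`hs := proj_undoubleLoc`, `hsm`, `hsu` from §1 (`|β| = 1`), the mixed model `(Γ, η)` of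
`exists_mixedModel_undoubleLoc_localSplittingDatumQuadExt'`, `hη := chi_det_symm_map`, `ν := χ.localComponent w`, `hν := rfl`.
[cite: Liu2021, App. D, Lemma D.1 (2) and proof of Lemma D.1 (first paragraph), p. 126]
[cite: Kudla1994, §3 Thm. 3.1] [cite: GelbartRogawski1991, §3.1 Prop. 3.1.1 p. 455] -/
theorem splitPlace_heckeOperator_localInt_apply_undoubleLoc_localSplittingDatumQuadExt
    (F : Type) [Field F] [NumberField F] (E : Type) [Field E] [NumberField E] [Algebra F E]
    [Algebra.IsQuadraticExtension F E] (c : E ≃ₐ[F] E) (hc1 : c ≠ 1) (δ : E) (hcδ : c δ = -δ)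
    (hδ : δ ≠ 0) (d : F) (hd : δ * δ = algebraMap F E d) (T : Matrix (Fin 2) (Fin 2) F) (hT : T.IsSymm) (hTd : IsUnit T.det)
    (t : Fin 2 → F) (hTt : T = Matrix.diagonal t)
    (J : Matrix (Fin 2) (Fin 2) E) (hJ : J = T.map (algebraMap F E)) (hJh : (J.map c)ᵀ = J)
    {JD : Matrix (Fin (2 + 2)) (Fin (2 + 2)) E} (hJD : JD = (gramD F 2 T).map (algebraMap F E))
    (v : HeightOneSpectrum (𝓞 F)) (w : UnitaryGroup.PlacesOver E v) (hw : c • (w : HeightOneSpectrum (𝓞 E)) ≠ w)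
    (hJw : IsUnit (UnitaryGroup.placeForm J (w : HeightOneSpectrum (𝓞 E))))
    [MeasurableSpace (v.adicCompletion F)] [BorelSpace (v.adicCompletion F)]
    (μ : Measure (v.adicCompletion F)) [μ.IsAddHaarMeasure]
    (χ : HeckeCharacter E) (hχ : IsSplittingCharExt F E 1 χ) (hχu : χ.IsUnitary)
    (s : UnitaryGroup.localPi E c 2 J v →* LocalMp F 2 T v)
    (hs : s = undoubleLoc F E c v 2 hJ hJD hcδ hδ hd hT hTd
      (localSplittingDatumQuadExt F E c hcδ hδ hd v μ 2 hT hTd hJD χ hχ).localSplitting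
      (localSplittingDatumQuadExt F E c hcδ hδ hd v μ 2 hT hTd hJD χ hχ).proj_localSplitting)
    (J₁ : Matrix (Fin 1) (Fin 1) E) (hJ₁ : J₁ 0 0 ≠ 0)
    [LocallyCompactSpace (standardParabolicGL ((w : HeightOneSpectrum (𝓞 E)).adicCompletion E)
      (Zelevinsky1980.lastBlockLabel 2))]
    (χc : UnitaryGroup.localPi E c 1 J₁ v →* ℂˣ) (hχcu : ∀ z, ‖((χc z : ℂˣ) : ℂ)‖ = 1)
    (hχcc : Continuous fun z => ((χc z : ℂˣ) : ℂ))
    (χ' : ((w : HeightOneSpectrum (𝓞 E)).adicCompletion E)ˣ →* ℂˣ)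
    (hχ' : ∀ z : UnitaryGroup.localPi E c 1 J₁ v,
      χ' (Matrix.GeneralLinearGroup.det ((z : UnitaryGroup.LocalGLPi E 1 v) w)) = χc z)
    (hJi : hJw.unit ∈ glInt 2 ((w : HeightOneSpectrum (𝓞 E)).adicCompletion E))
    {ϖ : (w : HeightOneSpectrum (𝓞 E)).adicCompletion E} (hϖ : IsUniformizingElement ϖ)
    {y : TwistedCoinv.Coinv
      (show Representation ℂ (UnitaryGroup.localPi E c 1 J₁ v) (SchwartzBruhat (Fin 2 → v.adicCompletion F)) from
        ((MpPsi.toRep (localSchrodinger F 2 T v)).comp s).comp (UnitaryGroup.localCenter E c 2 J J₁ hJ₁ v)) χc}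
    (hy : y ∈ (TwistedCoinv.rep
        (ρW := show Representation ℂ (UnitaryGroup.localPi E c 1 J₁ v) (SchwartzBruhat (Fin 2 → v.adicCompletion F)) from
          ((MpPsi.toRep (localSchrodinger F 2 T v)).comp s).comp (UnitaryGroup.localCenter E c 2 J J₁ hJ₁ v))
        χc ((MpPsi.toRep (localSchrodinger F 2 T v)).comp s)
        (fun g z => (show Commute g (UnitaryGroup.localCenter E c 2 J J₁ hJ₁ v z) from
          UnitaryGroup.localCenter_comm E c 2 J J₁ hJ₁ v z g).map ((MpPsi.toRep (localSchrodinger F 2 T v)).comp s))).fixedPoints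
        (UnitaryGroup.localInt E c 2 J v)) :
    heckeOperator
        (TwistedCoinv.rep
          (ρW := show Representation ℂ (UnitaryGroup.localPi E c 1 J₁ v) (SchwartzBruhat (Fin 2 → v.adicCompletion F)) from
            ((MpPsi.toRep (localSchrodinger F 2 T v)).comp s).comp (UnitaryGroup.localCenter E c 2 J J₁ hJ₁ v))
          χc ((MpPsi.toRep (localSchrodinger F 2 T v)).comp s)
          (fun g z => (show Commute g (UnitaryGroup.localCenter E c 2 J J₁ hJ₁ v z) from
            UnitaryGroup.localCenter_comm E c 2 J J₁ hJ₁ v z g).map ((MpPsi.toRep (localSchrodinger F 2 T v)).comp s)))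
        (UnitaryGroup.localInt E c 2 J v)
        ((UnitaryGroup.localPiSplitEquiv c J hc1 hJh w hw hJw).symm (heckeDiag 2 (Units.mk0 ϖ hϖ.ne_zero) 1)) y =
        ((Real.sqrt (GaloisRepresentations.IsNonarchimedeanLocalField.residueFieldCard
            ((w : HeightOneSpectrum (𝓞 E)).adicCompletion E)) : ℂ) *
          ((((χ.localComponent (w : HeightOneSpectrum (𝓞 E))) (Units.mk0 ϖ hϖ.ne_zero) : ℂˣ) : ℂ) +
            ((χ' (Units.mk0 ϖ hϖ.ne_zero) : ℂˣ) : ℂ) *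
              ((((χ.localComponent (w : HeightOneSpectrum (𝓞 E))) (Units.mk0 ϖ hϖ.ne_zero) : ℂˣ) : ℂ))⁻¹)) • y ∧
      heckeOperator
        (TwistedCoinv.rep
          (ρW := show Representation ℂ (UnitaryGroup.localPi E c 1 J₁ v) (SchwartzBruhat (Fin 2 → v.adicCompletion F)) from
            ((MpPsi.toRep (localSchrodinger F 2 T v)).comp s).comp (UnitaryGroup.localCenter E c 2 J J₁ hJ₁ v))
          χc ((MpPsi.toRep (localSchrodinger F 2 T v)).comp s)
          (fun g z => (show Commute g (UnitaryGroup.localCenter E c 2 J J₁ hJ₁ v z) from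
            UnitaryGroup.localCenter_comm E c 2 J J₁ hJ₁ v z g).map ((MpPsi.toRep (localSchrodinger F 2 T v)).comp s)))
        (UnitaryGroup.localInt E c 2 J v)
        ((UnitaryGroup.localPiSplitEquiv c J hc1 hJh w hw hJw).symm (heckeDiag 2 (Units.mk0 ϖ hϖ.ne_zero) 2)) y =
        ((χ' (Units.mk0 ϖ hϖ.ne_zero) : ℂˣ) : ℂ) • y := by
  subst hs
  haveI := secondCountableTopology_adicCompletion F v
  haveI : (Measure.pi fun _ : Fin 2 => μ).IsAddHaarMeasure := Measure.pi.isAddHaarMeasure _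
  obtain ⟨Γ, hΓi, hmodel⟩ := exists_mixedModel_undoubleLoc_localSplittingDatumQuadExt' F E c hcδ hδ hd v μ 2 hT hTd hJ
    hJD χ hχ two_pos t hTt w hw hc1 hJh (hermD_conj_transpose F E c 2 hT hJD) hJw (isUnit_placeFormD F E v 2 hTd hJD w) μ
  exact splitPlace_chiCoinv_heckeOperator_localInt_apply_explicit F E c hc1 δ hcδ hδ d hd T hT hTd J hJ hJh v w hw hJw
    (Measure.pi fun _ : Fin 2 => μ) _
    (proj_undoubleLoc F E c v 2 hJ hJD hcδ hδ hd hT hTd _ _)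
    (isSmooth_toRep_comp_undoubleLoc F E c hcδ hδ hd v μ 2 hT hTd hJ hJD _)
    (isL2Isometric_toRep_comp_undoubleLoc F E c hcδ hδ hd v μ 2 hT hTd hJ hJD _
      (norm_beta_localSplittingDatumQuadExt_eq_one F E c hcδ hδ hd v μ 2 hT hTd hJD χ hχ hχu) μ)
    J₁ hJ₁ μ Γ _ hΓi hmodel
    ((χ.localComponent (w : HeightOneSpectrum (𝓞 E))).comp
      (Units.map (toPlace v w : v.adicCompletion F →+* (w : HeightOneSpectrum (𝓞 E)).adicCompletion E).toMonoidHom))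
    (chi_det_symm_map F E c v 2 hc1 hJh w hw hJw (χ.localComponent (w : HeightOneSpectrum (𝓞 E))))
    (χ.localComponent (w : HeightOneSpectrum (𝓞 E))) (fun _ => rfl) χc hχcu hχcc χ' hχ' hJi hϖ hy

/-! ## §3 The CM package: `s = localSplittingCM L 2 … θ hθ v`, `ν = θ_w` -/

set_option maxHeartbeats 2000000 in -- as above
/-- **[Liu2021, Lem. D.1 (2)] at a split place for THE CM PACKAGE `localSplittingCM` of the tree, `ν = θ_w` at EITHER `w ∣ v`.**
For a CM field `L/L⁺` (`c` = complex conjugation), `T₀ = diag t ∈ GL₂(L⁺)`, `J = T₀ ⊗ 1`, a unitary splitting character `θ`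
of `L` (`IsSplittingChar L 1 θ`), a place `v` of `L⁺` split in `L` and ANY `w ∣ v` with `c • w ≠ w`: on every
`U(J)(𝒪_v)`-fixed vector of the `χc`-coinvariants of `ω_s`, `s := localSplittingCM L 2 hT₀ hT₀d hJ θ hθ v` (the member at
`v` of `finLocalSplittingsCM`, `finLocalSplittingsCM_s`), the operators of `e_w⁻¹(diag(ϖ, 1))`, `e_w⁻¹(diag(ϖ, ϖ))` act by
`q_w^{1/2}(θ_w(ϖ) + χ′(ϖ)θ_w(ϖ)⁻¹)` and `χ′(ϖ)` — NO measure, NO model data, NO chosen place in the statement.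
Proof: §2 at `(L⁺, L, c, imagUnit L)` with the Borel σ-algebra and `Measure.addHaar` (`localSplittingCM` unfolds to
`undoubleLoc (localSplittingDatumCM …).localSplitting`, and `localSplittingDatumCM = localSplittingDatumQuadExt …` is
`localSplittingDatumCM_eq`, `rfl`).
[cite: Liu2021, App. D, Lemma D.1 (2) and proof of Lemma D.1 (first paragraph), p. 126]
[cite: GelbartRogawski1991, §3.1 Prop. 3.1.1 p. 455] [cite: Kudla1994, §3 Thm. 3.1] -/
theorem splitPlace_heckeOperator_localInt_apply_localSplittingCM
    (L : Type) [Field L] [NumberField L] [IsCMField L] (hc1 : IsCMField.complexConj L ≠ 1)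
    (T₀ : Matrix (Fin 2) (Fin 2) (maximalRealSubfield L)) (hT₀ : T₀.IsSymm) (hT₀d : IsUnit T₀.det)
    (t : Fin 2 → maximalRealSubfield L) (hT₀t : T₀ = Matrix.diagonal t)
    (J : Matrix (Fin 2) (Fin 2) L) (hJ : J = T₀.map (algebraMap (maximalRealSubfield L) L))
    (hJh : (J.map (IsCMField.complexConj L))ᵀ = J)
    (v : HeightOneSpectrum (𝓞 (maximalRealSubfield L))) (w : UnitaryGroup.PlacesOver L v)
    (hw : IsCMField.complexConj L • (w : HeightOneSpectrum (𝓞 L)) ≠ w)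
    (hJw : IsUnit (UnitaryGroup.placeForm J (w : HeightOneSpectrum (𝓞 L))))
    (θ : HeckeCharacter L) (hθ : IsSplittingChar L 1 θ) (hθu : θ.IsUnitary)
    (J₁ : Matrix (Fin 1) (Fin 1) L) (hJ₁ : J₁ 0 0 ≠ 0)
    [LocallyCompactSpace (standardParabolicGL ((w : HeightOneSpectrum (𝓞 L)).adicCompletion L)
      (Zelevinsky1980.lastBlockLabel 2))]
    (χc : UnitaryGroup.localPi L (IsCMField.complexConj L) 1 J₁ v →* ℂˣ) (hχcu : ∀ z, ‖((χc z : ℂˣ) : ℂ)‖ = 1)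
    (hχcc : Continuous fun z => ((χc z : ℂˣ) : ℂ))
    (χ' : ((w : HeightOneSpectrum (𝓞 L)).adicCompletion L)ˣ →* ℂˣ)
    (hχ' : ∀ z : UnitaryGroup.localPi L (IsCMField.complexConj L) 1 J₁ v,
      χ' (Matrix.GeneralLinearGroup.det ((z : UnitaryGroup.LocalGLPi L 1 v) w)) = χc z)
    (hJi : hJw.unit ∈ glInt 2 ((w : HeightOneSpectrum (𝓞 L)).adicCompletion L))
    {ϖ : (w : HeightOneSpectrum (𝓞 L)).adicCompletion L} (hϖ : IsUniformizingElement ϖ)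
    {y : TwistedCoinv.Coinv
      (show Representation ℂ (UnitaryGroup.localPi L (IsCMField.complexConj L) 1 J₁ v)
          (SchwartzBruhat (Fin 2 → v.adicCompletion (maximalRealSubfield L))) from
        ((MpPsi.toRep (localSchrodinger (maximalRealSubfield L) 2 T₀ v)).comp
          (localSplittingCM L 2 hT₀ hT₀d hJ θ hθ v)).comp
          (UnitaryGroup.localCenter L (IsCMField.complexConj L) 2 J J₁ hJ₁ v)) χc}
    (hy : y ∈ (TwistedCoinv.rep
        (ρW := show Representation ℂ (UnitaryGroup.localPi L (IsCMField.complexConj L) 1 J₁ v)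
            (SchwartzBruhat (Fin 2 → v.adicCompletion (maximalRealSubfield L))) from
          ((MpPsi.toRep (localSchrodinger (maximalRealSubfield L) 2 T₀ v)).comp
            (localSplittingCM L 2 hT₀ hT₀d hJ θ hθ v)).comp
            (UnitaryGroup.localCenter L (IsCMField.complexConj L) 2 J J₁ hJ₁ v))
        χc ((MpPsi.toRep (localSchrodinger (maximalRealSubfield L) 2 T₀ v)).comp (localSplittingCM L 2 hT₀ hT₀d hJ θ hθ v))
        (fun g z => (show Commute g (UnitaryGroup.localCenter L (IsCMField.complexConj L) 2 J J₁ hJ₁ v z) from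
          UnitaryGroup.localCenter_comm L (IsCMField.complexConj L) 2 J J₁ hJ₁ v z g).map
          ((MpPsi.toRep (localSchrodinger (maximalRealSubfield L) 2 T₀ v)).comp
            (localSplittingCM L 2 hT₀ hT₀d hJ θ hθ v)))).fixedPoints
        (UnitaryGroup.localInt L (IsCMField.complexConj L) 2 J v)) :
    heckeOperator
        (TwistedCoinv.rep
          (ρW := show Representation ℂ (UnitaryGroup.localPi L (IsCMField.complexConj L) 1 J₁ v)
              (SchwartzBruhat (Fin 2 → v.adicCompletion (maximalRealSubfield L))) from
            ((MpPsi.toRep (localSchrodinger (maximalRealSubfield L) 2 T₀ v)).comp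
              (localSplittingCM L 2 hT₀ hT₀d hJ θ hθ v)).comp
              (UnitaryGroup.localCenter L (IsCMField.complexConj L) 2 J J₁ hJ₁ v))
          χc ((MpPsi.toRep (localSchrodinger (maximalRealSubfield L) 2 T₀ v)).comp (localSplittingCM L 2 hT₀ hT₀d hJ θ hθ v))
          (fun g z => (show Commute g (UnitaryGroup.localCenter L (IsCMField.complexConj L) 2 J J₁ hJ₁ v z) from
            UnitaryGroup.localCenter_comm L (IsCMField.complexConj L) 2 J J₁ hJ₁ v z g).map
            ((MpPsi.toRep (localSchrodinger (maximalRealSubfield L) 2 T₀ v)).comp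
              (localSplittingCM L 2 hT₀ hT₀d hJ θ hθ v))))
        (UnitaryGroup.localInt L (IsCMField.complexConj L) 2 J v)
        ((UnitaryGroup.localPiSplitEquiv (IsCMField.complexConj L) J hc1 hJh w hw hJw).symm
          (heckeDiag 2 (Units.mk0 ϖ hϖ.ne_zero) 1)) y =
        ((Real.sqrt (GaloisRepresentations.IsNonarchimedeanLocalField.residueFieldCard
            ((w : HeightOneSpectrum (𝓞 L)).adicCompletion L)) : ℂ) *
          ((((θ.localComponent (w : HeightOneSpectrum (𝓞 L))) (Units.mk0 ϖ hϖ.ne_zero) : ℂˣ) : ℂ) +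
            ((χ' (Units.mk0 ϖ hϖ.ne_zero) : ℂˣ) : ℂ) *
              ((((θ.localComponent (w : HeightOneSpectrum (𝓞 L))) (Units.mk0 ϖ hϖ.ne_zero) : ℂˣ) : ℂ))⁻¹)) • y ∧
      heckeOperator
        (TwistedCoinv.rep
          (ρW := show Representation ℂ (UnitaryGroup.localPi L (IsCMField.complexConj L) 1 J₁ v)
              (SchwartzBruhat (Fin 2 → v.adicCompletion (maximalRealSubfield L))) from
            ((MpPsi.toRep (localSchrodinger (maximalRealSubfield L) 2 T₀ v)).comp
              (localSplittingCM L 2 hT₀ hT₀d hJ θ hθ v)).comp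
              (UnitaryGroup.localCenter L (IsCMField.complexConj L) 2 J J₁ hJ₁ v))
          χc ((MpPsi.toRep (localSchrodinger (maximalRealSubfield L) 2 T₀ v)).comp (localSplittingCM L 2 hT₀ hT₀d hJ θ hθ v))
          (fun g z => (show Commute g (UnitaryGroup.localCenter L (IsCMField.complexConj L) 2 J J₁ hJ₁ v z) from
            UnitaryGroup.localCenter_comm L (IsCMField.complexConj L) 2 J J₁ hJ₁ v z g).map
            ((MpPsi.toRep (localSchrodinger (maximalRealSubfield L) 2 T₀ v)).comp
              (localSplittingCM L 2 hT₀ hT₀d hJ θ hθ v))))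
        (UnitaryGroup.localInt L (IsCMField.complexConj L) 2 J v)
        ((UnitaryGroup.localPiSplitEquiv (IsCMField.complexConj L) J hc1 hJh w hw hJw).symm
          (heckeDiag 2 (Units.mk0 ϖ hϖ.ne_zero) 2)) y =
        ((χ' (Units.mk0 ϖ hϖ.ne_zero) : ℂˣ) : ℂ) • y := by
  letI : MeasurableSpace (v.adicCompletion (maximalRealSubfield L)) := borel _
  haveI : BorelSpace (v.adicCompletion (maximalRealSubfield L)) := ⟨rfl⟩
  exact splitPlace_heckeOperator_localInt_apply_undoubleLoc_localSplittingDatumQuadExt (maximalRealSubfield L) L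
    (IsCMField.complexConj L) hc1 (imagUnit L) (complexConj_imagUnit L) (imagUnit_ne_zero L) _ (imagUnit_mul_self L) T₀ hT₀
    hT₀d t hT₀t J hJ hJh rfl v w hw hJw Measure.addHaar θ ((isSplittingChar_iff_isSplittingCharExt L 1 θ).1 hθ) hθu
    (localSplittingCM L 2 hT₀ hT₀d hJ θ hθ v) rfl J₁ hJ₁ χc hχcu hχcc χ' hχ' hJi hϖ hy

end Literature.NumberTheory.Automorphic.Liu2021

end
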